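import Summits.BirchSwinnertonDyer.BirchSwinnertonDyer.Theorems.ByReductionTypeAtTwoRankOneAtTwoBigImageOddLocalOneDoorBottomPosStepB
import Summits.BirchSwinnertonDyer.BirchSwinnertonDyer.Theorems.ByReductionTypeAtTwoRankOneAtTwoOffBigImageOddLocalEngineChebotarev
import Summits.BirchSwinnertonDyer.BirchSwinnertonDyer.Theorems.ByReductionTypeAtTwoRankOneAtTwoBigImageOddLocalOneDoorBottomTranspositionCount
import Literature.NumberTheory.EllipticCurves.TorsionLocalKernelRestrictionProofs
import Literature.NumberTheory.Automorphic.TunnellLemma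
import HarnessLib

/-!
# Route ByReductionTypeAtTwo, crux `RankOneAtTwoBigImageOddLocal` (stmt-BirchSwinnertonDyer-23715), LINE v8.10 `one_door_analytic`:
# U₀⁺ (`stub_firstDescentLeavesPos`, `Δ_W > 0`) — THE REGULAR-PRIME ČEBOTAREV SUPPLY, leaves `ceb₁` / `ceb₂` / `ceb₂'`

Width prover seat `bsd-line-fkl-p2` g11 (2026-08-28), `--supports stmt-BirchSwinnertonDyer-23715` (helper).  THEOREMS ONLY (no
definition, no named fact, no `sorry`).  BSD is not proved by any of this.

The Čebotarev leaves of Kolyvagin's first `2`-descent over `ℚ` at a `Δ_W > 0` bottom-rung datum (MEMO-es §18.11; the lead's 16:52Z target):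
REGULAR Kolyvagin primes `ℓ` — inert in `K`, Frobenius a TRANSPOSITION on `E[2]` (`(Δ_min/ℓ) = −1`), `a_ℓ` even — in the currency
`jacobiSym W.Δ.num ℓ = -1 ∧ Zhang2014.IsKolyvaginPrime N W K 2 ℓ ∧ 1 ≤ Zhang2014.kolyvaginIndex W 2 ℓ` (the proposed body of `KolPos W K ℓ`,
twin of `KolNeg`), at whose place prescribed classes of `H¹(ℚ, W[2])` / `H¹(ℚ, W^{(d_K)}[2])` do not vanish.

* §1 `exists_prime_of_galoisElement_regular_one` — the 23716 lead's LANDED Steps C–H for a regular element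
  (`OffBigImageOddLocalAtTwo.Engine.exists_kolyvaginPrime_gt_two_of_galoisElement_regular`) at `M = 1` (its `μ_{2^M}`-hypothesis is vacuous), with
  Čebotarev's theorem `Automorphic.chebotarev_artinRep_of_galoisSide`;
* §2 **`exists_regularKolyvaginPrime_two`** — Step B (`exists_regular_galoisElement_two`, sibling `…OneDoorBottomPosStepB`) fed to §1 for a family of
  pairs `(u_i, v_i)`; the regularity is read back as `(Δ_min/ℓ) = −1` through the sign of the Frobenius permutation of `{T₀, T₁, T₂}`
  (`sign_permGal_eq_legendreSym_of_isArithFrobAt`, fkl-p2 g10);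
* §3 the record shapes over `ℚ` (local transfer `K_λ → ℚ_ℓ` by `resTorsion_mem_torsionLocalKer_of_under` and `mem_torsionLocalKer_iff_hPsiKT_mem`):
  **`ceb₂_pos_rat`** (E-side pair), **`ceb₁_pos_rat`** (single class), **`ceb₂'_pos_rat`** (cross pair `s' ∈ H¹(ℚ, W^{(d)}[2])`, `y ∈ H¹(ℚ, W[2])`,
  NO distinctness hypothesis — the twin copy `hPsiKT (res s') = res y` is served by the single-class family).

References: [McCallumLMS1991] §3 Prop. 3.1, Cor. 3.2, p. 299; [GrossLMS1991] §3 (3.1)–(3.3), §9, §10; [Kolyvagin1989Izv] §3; [Kramer1981] Prop. 3;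
[WZhang2014] Notations (xii).
-/

set_option autoImplicit false
-- the Theorems namespace of this sub repeats the summit name by design (D-0017 nested layout)
set_option linter.dupNamespace false

noncomputable section

open scoped Classical

namespace Summit.BirchSwinnertonDyer.BirchSwinnertonDyer.Theorems.RankOneAtTwoOneDoor

open WeierstrassCurve NumberField IsDedekindDomain Field Finset
open Literature.NumberTheory.EllipticCurves Literature.NumberTheory.GaloisRepresentations Literature.NumberTheory
open Literature.NumberTheory.EllipticCurves.DokchitserDokchitser2012
open Summit.BirchSwinnertonDyer.BirchSwinnertonDyer.Theorems.GenusExact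
open Summit.BirchSwinnertonDyer.BirchSwinnertonDyer.Theorems.GenusExact.EigenClassesFinite
open Summit.BirchSwinnertonDyer.BirchSwinnertonDyer.Theorems.GenusExact.SelmerDescent

/-! ## §1 Steps C–H at `M = 1` (the 23716 lead's regular engine, read at level `2`) -/

section Engine

variable {W : WeierstrassCurve ℚ} {K : Type} [Field K] [NumberField K]

omit [NumberField K] in
/-- `n • v = 0` for `v ∈ E[n]`. [folklore] -/
theorem zsmul_self_geomTorsion (X : WeierstrassCurve K) (n : ℤ) (v : geomTorsion X n) : n • v = 0 :=
  Subtype.ext (by rw [AddSubgroupClass.coe_zsmul, ZeroMemClass.coe_zero]; exact (mem_geomTorsion_iff X n _).mp v.2)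

/-- **Steps C–H at `M = 1`.**  `K` imaginary quadratic, `c₀` a complex conjugation, `c ≠ 1`, classes `c_i ∈ H¹(K, E_K[2])`, `ρ ∈ Γ_K` with
`(c₀ · res ρ)² = 1` on `E[2]` such that for every `m` in the joint evaluation kernel `[c_i, (ρm)^τ(ρm)] ≠ 0`: then beyond every bound a prime
`ℓ ∤ 2 N d_K`, inert in `K`, with a Frobenius above `ℓ` acting on `E[2]` as `c₀ · res ρ` and on `K` as `c₀`, `2 ∣ ℓ + 1`, `2 ∣ a_ℓ`, and
`c_i ∉ torsionLocalKer_w(E_K)` at the place `w ∋ ℓ`.  One-line specialisation of the 23716 lead's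
`OffBigImageOddLocalAtTwo.Engine.exists_kolyvaginPrime_gt_two_of_galoisElement_regular` (its `μ_{2^M}`-hypothesis is vacuous at `M = 1`),
with Čebotarev's theorem `Automorphic.chebotarev_artinRep_of_galoisSide`. [cite: McCallumLMS1991, §3 Cor. 3.2 (proof)]
[cite: GrossLMS1991, §3 (3.1)–(3.3)] -/
theorem exists_prime_of_galoisElement_regular_one {N : ℕ} [NeZero N] [W.IsElliptic] [W.IsGloballyMinimal]
    (hK : IsImaginaryQuadratic K) {c₀ : absoluteGaloisGroup ℚ} (hc₀ : IsComplexConjugation (Rat.castHom ℝ) c₀)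
    {c : K ≃ₐ[ℚ] K} (hc : c ≠ 1) {r : ℕ} (cs : Fin r → galH1Torsion (W.baseChange K) 2) {ρ : absoluteGaloisGroup K}
    (hsq : ∀ P : geomTorsion W 2, (c₀ * absGaloisRestrict ℚ K ρ) • (c₀ * absGaloisRestrict ℚ K ρ) • P = P)
    (hρ : ∀ m ∈ evalKer (W.baseChange K) 2 cs, ∀ i,
      h1Eval (W.baseChange K) 2 (cs i)
        ((RatClosure.isLiftOfAut_absGaloisTransport_of_isImaginaryQuadratic hK hc hc₀).conjGalCMH (ρ * m) * (ρ * m)) ≠ 0)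
    (b : ℕ) :
    ∃ ℓ : ℕ, b < ℓ ∧ ℓ.Prime ∧ ¬ ℓ ∣ N ∧ ¬ ((ℓ : ℤ) ∣ NumberField.discr K) ∧ ℓ ≠ 2 ∧ (Ideal.span {(ℓ : 𝓞 K)}).IsPrime ∧
      (∃ (v : HeightOneSpectrum (𝓞 ℚ)) (𝔓 : Ideal (absIntegers (𝓞 ℚ) ℚ)) (h : absoluteGaloisGroup ℚ),
        (ℓ : 𝓞 ℚ) ∈ v.asIdeal ∧ 𝔓 ∈ v.primesAbove ∧ IsArithFrobAt (𝓞 ℚ) h 𝔓 ∧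
        (∀ P : geomTorsion W 2, h • P = (c₀ * absGaloisRestrict ℚ K ρ) • P) ∧
        ∀ (e : K →ₐ[ℚ] AlgebraicClosure ℚ) (x : K), h • e x = c₀ • e x) ∧
      2 ∣ ℓ + 1 ∧ (2 : ℤ) ∣ W.frobeniusTrace ℓ ∧
      ∀ i, ∀ w : HeightOneSpectrum (𝓞 K), (ℓ : 𝓞 K) ∈ w.asIdeal →
        cs i ∉ (W.baseChange K).torsionLocalKer (w.adicCompletion K) 2 := by
  obtain ⟨ℓ, hbℓ, hℓ, hℓN, hℓD, hℓ2, hprime, ⟨v, 𝔓, h, hℓv, h𝔓, hFrob, hE, hKc⟩, hdvd1, hdvd2, hloc⟩ :=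
    OffBigImageOddLocalAtTwo.Engine.exists_kolyvaginPrime_gt_two_of_galoisElement_regular
      Automorphic.chebotarev_artinRep_of_galoisSide (N := N) (W := W) hK (M := 1) le_rfl hc₀ hc cs (fun _ => 1) (ρ := ρ)
      (fun P => hsq P)
      (fun ζ hζ => by
        rw [pow_one, sq_eq_one_iff] at hζ
        rcases hζ with rfl | rfl
        · rw [smul_one, inv_one]
        · rw [smul_neg, smul_one, inv_neg_one])
      (fun m hm i => ⟨by simpa using zsmul_self_geomTorsion (W.baseChange K) _ (h1Eval (W.baseChange K) _ (cs i) _),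
        fun _ => by rw [Nat.sub_self, pow_zero, one_smul]; exact hρ m hm i⟩)
      b
  refine ⟨ℓ, hbℓ, hℓ, hℓN, hℓD, hℓ2, hprime, ⟨v, 𝔓, h, hℓv, h𝔓, hFrob, fun P => hE P, hKc⟩, by simpa using hdvd1,
    by simpa using hdvd2, fun i w hw hmem => ?_⟩
  exact (hloc i w hw).2 one_ne_zero (by rw [Nat.sub_self, pow_zero, one_smul]; exact hmem)

end Engine

/-! ## §2 The regular-prime supply for a family of pairs -/

section Supply

variable (N : ℕ) [NeZero N] (W : WeierstrassCurve ℚ) [W.IsElliptic] [W.IsGloballyMinimal] {K : Type} [Field K] [NumberField K]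

/-- **THE REGULAR-PRIME SUPPLY at `Δ_W > 0`** (MEMO-es §18.11; card `regular-frobenius-kolyvagin-primes-pos-disc`).  `W/ℚ` globally minimal
with `Δ_W > 0`, `ρ̄_{W,2}` onto, `N_W ∣ N`; `K = ℚ(θ)` imaginary quadratic, `θ² = d`, with `d_K · Δ_W ∉ ℚ^{×2}` and `W^{(d)}` elliptic with
`Δ > 0`; pairs `(u_i, v_i) ∈ H¹(ℚ, W[2]) × H¹(ℚ, W^{(d)}[2])` with `𝔽₂`-independent descended classes `c_i = res u_i + hPsiKT (res v_i)`.  THEN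
for every `b` there is a prime `ℓ > b` with `(Δ_min/ℓ) = −1` (the Frobenius a TRANSPOSITION on `E[2]`, so `#E(ℚ_ℓ)[2] = 2`), `ℓ` a
Zhang–Kolyvagin prime at `2` of level `N` (`ℓ ∤ 2 N d_K`, inert in `K`, `2 ∣ a_ℓ`), Kolyvagin index `≥ 1`, at whose place `λ` NONE of the
`c_i` vanishes.  Proof: Step B (`exists_regular_galoisElement_two`) fed to Steps C–H (§1); `(Δ_min/ℓ) =` sign of the Frobenius
permutation of `{T₀, T₁, T₂}` (`sign_permGal_eq_legendreSym_of_isArithFrobAt`), which is `swapAut`'s `(0 1)`.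
[cite: McCallumLMS1991, §3 Cor. 3.2] [cite: GrossLMS1991, §3 (3.1)–(3.3), §10] [cite: Kramer1981, Prop. 3] -/
theorem exists_regularKolyvaginPrime_two (hN : W.conductorNorm ℤ ∣ N) (hΔ : 0 < W.Δ) (hK : IsImaginaryQuadratic K)
    (hns : ¬ IsSquare ((NumberField.discr K : ℚ) * W.Δ)) (hsurj : W.HasSurjectiveModNGaloisRep 2)
    {θ : K} (hθ : θ ∉ Set.range (algebraMap ℚ K)) {d : ℚ} (hcθ : θ ^ 2 = algebraMap ℚ K d)
    [(W.quadraticTwist d).IsElliptic] (hΔ' : 0 < (W.quadraticTwist d).Δ)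
    {r : ℕ} (us : Fin r → galH1Torsion W 2) (vs : Fin r → galH1Torsion (W.quadraticTwist d) 2)
    (hind : ∀ a : Fin r → ℤ,
      ∑ i, a i • (resTorsion W K 2 (us i) + hPsiKT W K hθ hcθ 2 (resTorsion (W.quadraticTwist d) K 2 (vs i))) = 0 →
        ∀ i, (2 : ℤ) ∣ a i) (b : ℕ) :
    ∃ ℓ : ℕ, b < ℓ ∧ jacobiSym W.Δ.num ℓ = -1 ∧ Zhang2014.IsKolyvaginPrime N W K 2 ℓ ∧ 1 ≤ Zhang2014.kolyvaginIndex W 2 ℓ ∧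
      ∀ i, ∀ w : HeightOneSpectrum (𝓞 K), (ℓ : 𝓞 K) ∈ w.asIdeal →
        resTorsion W K 2 (us i) + hPsiKT W K hθ hcθ 2 (resTorsion (W.quadraticTwist d) K 2 (vs i)) ∉
          (W.baseChange K).torsionLocalKer (w.adicCompletion K) 2 := by
  haveI : Fact (Nat.Prime 2) := ⟨Nat.prime_two⟩
  have h2K : Module.finrank ℚ K = 2 := hK.1
  obtain ⟨c₀, hc₀⟩ := exists_isComplexConjugation (Rat.castHom ℝ)
  have hc : sigmaQ K h2K hθ hcθ ≠ 1 := sigmaQ_ne_one K h2K hθ hcθ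
  obtain ⟨ρ, hρsw, hρev⟩ := exists_regular_galoisElement_two W K hΔ hK hns hsurj hθ hcθ hΔ' hc₀ hc us vs hind
  have hsq : ∀ P : geomTorsion W 2, (c₀ * absGaloisRestrict ℚ K ρ) • (c₀ * absGaloisRestrict ℚ K ρ) • P = P := fun P => by
    rw [hρsw, hρsw, swapAut_swapAut]
  obtain ⟨ℓ, hbℓ, hℓ, hℓN, hℓD, hℓ2, hprime, ⟨v, 𝔓, h, hℓv, h𝔓, hFrob, hE, -⟩, hdvd1, hdvd2, hloc⟩ :=
    exists_prime_of_galoisElement_regular_one (N := N) hK hc₀ hc _ hsq hρev b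
  haveI : Fact ℓ.Prime := ⟨hℓ⟩
  -- Kolyvagin index and Zhang's predicate
  have hidx : 1 ≤ Zhang2014.kolyvaginIndex W 2 ℓ :=
    (Zhang2014.le_kolyvaginIndex_iff (W := W) (p := 2)).mpr ⟨by simpa using hdvd1, by simpa using hdvd2⟩
  have hKol : Zhang2014.IsKolyvaginPrime N W K 2 ℓ := ⟨hℓ, hℓN, hℓD, hℓ2, hprime, hidx⟩
  -- `(Δ_min/ℓ) = −1`: the Frobenius `h` acts on `E[2]` as the transposition `swapAut`
  have hℓNW : ¬ ℓ ∣ W.conductorNorm ℤ := fun hd => hℓN (hd.trans hN)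
  have hgood : W.HasGoodReductionAtPrime ℓ := hasGoodReductionAtPrime_of_not_dvd_conductorNorm W hℓNW
  have hnum : W.Δ.num = minimalDiscriminantInt W := by rw [← cast_minimalDiscriminantInt W, Rat.num_intCast]
  have hΔeq : W.Δ = (W.Δ.num : ℚ) := by rw [hnum, cast_minimalDiscriminantInt]
  have hℓΔ : ¬ (ℓ : ℤ) ∣ W.Δ.num := by
    rw [hnum]; exact not_dvd_minimalDiscriminantInt_of_hasGoodReductionAtPrime' W ℓ hgood
  have hperm : permGal W (two_ne_zero : (2 : ℚ) ≠ 0) h = Equiv.swap 0 1 := by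
    have hrho : rho W h = swapAut W (two_ne_zero : (2 : ℚ) ≠ 0) :=
      AddEquiv.ext fun P => by rw [rho_apply]; exact (hE P).trans (hρsw P)
    rw [permGal, hrho, perm_swapAut]
  have hsignQ := sign_permGal_eq_legendreSym_of_isArithFrobAt W hΔeq hℓ2 hℓΔ hℓv h𝔓 hFrob
  rw [hperm, Equiv.Perm.sign_swap (by decide)] at hsignQ
  have hleg : legendreSym ℓ W.Δ.num = -1 := by exact_mod_cast hsignQ.symm
  have hjac : jacobiSym W.Δ.num ℓ = -1 := by rw [← jacobiSym.legendreSym.to_jacobiSym]; exact hleg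
  exact ⟨ℓ, hbℓ, hjac, hKol, hidx, hloc⟩

end Supply

/-! ## §3 The three shapes of the record: `ceb₁`, `ceb₂` (E-side pair), `ceb₂'` (cross pair) — over `ℚ` -/

section Shapes

variable (N : ℕ) [NeZero N] (W : WeierstrassCurve ℚ) [W.IsElliptic] [W.IsGloballyMinimal] {K : Type} [Field K] [NumberField K]

/-- `2 ∣ a` when `a • x = 0` for a non-zero `2`-torsion element `x`. [folklore] -/
theorem two_dvd_of_zsmul_eq_zero {V : Type*} [AddCommGroup V] {x : V} (h2 : (2 : ℤ) • x = 0) (hx : x ≠ 0) {a : ℤ} (h : a • x = 0) :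
    (2 : ℤ) ∣ a := by
  rcases zsmul_eq_zero_or_eq_of_two_zsmul h2 a with h0 | h1
  · rcases Int.emod_two_eq_zero_or_one a with he | ho
    · exact Int.dvd_of_emod_eq_zero he
    · exfalso
      obtain ⟨k, hk⟩ : ∃ k, a = 2 * k + 1 := ⟨a / 2, by omega⟩
      apply hx
      rw [hk, add_zsmul, one_zsmul, mul_comm, mul_zsmul, h2, zsmul_zero, zero_add] at h
      exact h
  · rw [h1] at h; exact absurd h hx

omit [W.IsElliptic] [W.IsGloballyMinimal] in
/-- A regular Kolyvagin prime of `W` seen from `ℚ`: the local transfer `ℚ_v → K_w` at the place `w = (ℓ)` above `v ∋ ℓ`. For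
`u ∈ H¹(ℚ, W[2])`, `v' ∈ H¹(ℚ, W^{(d)}[2])`: if `res u + hPsiKT (res v')` does not vanish at `w`, then `u` vanishing at `v` forces `v'` NOT to
vanish at `v`, and `v'` vanishing at `v` forces `u` not to (`resTorsion_mem_torsionLocalKer_of_under`, `mem_torsionLocalKer_iff_hPsiKT_mem`).
[cite: McCallumLMS1991, §3 (3)] [cite: SerreGaloisCohomology1997, II.§1.1] -/
theorem not_mem_and_of_not_mem_place {θ : K} (hθ : θ ∉ Set.range (algebraMap ℚ K)) {d : ℚ} (hcθ : θ ^ 2 = algebraMap ℚ K d)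
    {ℓ : ℕ} (hℓ : ℓ.Prime) (hprime : (Ideal.span {(ℓ : 𝓞 K)}).IsPrime)
    (u : galH1Torsion W 2) (v' : galH1Torsion (W.quadraticTwist d) 2)
    (hK : ∀ w : HeightOneSpectrum (𝓞 K), (ℓ : 𝓞 K) ∈ w.asIdeal →
      resTorsion W K 2 u + hPsiKT W K hθ hcθ 2 (resTorsion (W.quadraticTwist d) K 2 v') ∉
        (W.baseChange K).torsionLocalKer (w.adicCompletion K) 2)
    {v : HeightOneSpectrum (𝓞 ℚ)} (hℓv : (ℓ : 𝓞 ℚ) ∈ v.asIdeal) :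
    (u ∈ W.torsionLocalKer (v.adicCompletion ℚ) 2 → v' ∉ (W.quadraticTwist d).torsionLocalKer (v.adicCompletion ℚ) 2) ∧
      (v' ∈ (W.quadraticTwist d).torsionLocalKer (v.adicCompletion ℚ) 2 → u ∉ W.torsionLocalKer (v.adicCompletion ℚ) 2) := by
  set w : HeightOneSpectrum (𝓞 K) := ⟨Ideal.span {(ℓ : 𝓞 K)}, hprime, by
    rw [Ne, Ideal.span_singleton_eq_bot]; exact_mod_cast hℓ.ne_zero⟩ with hw
  have hℓw : (ℓ : 𝓞 K) ∈ w.asIdeal := Ideal.mem_span_singleton_self _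
  have hunder : w.under (𝓞 ℚ) = v := by
    apply HeightOneSpectrum.eq_of_natCast_mem_rat hℓ _ hℓv
    rw [HeightOneSpectrum.under_asIdeal, Ideal.under_def, Ideal.mem_comap, map_natCast]
    exact hℓw
  subst hunder
  have key : u ∈ W.torsionLocalKer ((w.under (𝓞 ℚ)).adicCompletion ℚ) 2 →
      v' ∈ (W.quadraticTwist d).torsionLocalKer ((w.under (𝓞 ℚ)).adicCompletion ℚ) 2 → False := fun hu hv' =>
    hK w hℓw (AddSubgroup.add_mem _ (resTorsion_mem_torsionLocalKer_of_under W K 2 w hu)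
      ((mem_torsionLocalKer_iff_hPsiKT_mem W K hθ hcθ 2 (w.adicCompletion K) _).mp
        (resTorsion_mem_torsionLocalKer_of_under (W.quadraticTwist d) K 2 w hv')))
  exact ⟨fun hu hv' => key hu hv', fun hv' hu => key hu hv'⟩

/-- **`ceb₂` at `Δ_W > 0` — the regular-prime Čebotarev for an E-side PAIR.**  `s, y ∈ H¹(ℚ, W[2])` non-zero and distinct: for every
`b` a regular Kolyvagin prime `ℓ > b` (`(Δ_min/ℓ) = −1`, `Zhang2014.IsKolyvaginPrime N W K 2 ℓ`, index `≥ 1`) at whose place NEITHER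
`s` NOR `y` vanishes.  (Family `((s, 0), (y, 0))`; independence from the injectivity of `res` and §1 of `…OneDoorBottomCebotarev`.)
[cite: McCallumLMS1991, §3 Cor. 3.2] [cite: GrossLMS1991, §10] -/
theorem ceb₂_pos_rat (hN : W.conductorNorm ℤ ∣ N) (hΔ : 0 < W.Δ) (hK : IsImaginaryQuadratic K)
    (hns : ¬ IsSquare ((NumberField.discr K : ℚ) * W.Δ)) (hsurj : W.HasSurjectiveModNGaloisRep 2)
    {θ : K} (hθ : θ ∉ Set.range (algebraMap ℚ K)) {d : ℚ} (hcθ : θ ^ 2 = algebraMap ℚ K d)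
    [(W.quadraticTwist d).IsElliptic] (hΔ' : 0 < (W.quadraticTwist d).Δ)
    (s y : galH1Torsion W 2) (hs0 : s ≠ 0) (hy0 : y ≠ 0) (hsy : s ≠ y) (b : ℕ) :
    ∃ ℓ : ℕ, b < ℓ ∧ jacobiSym W.Δ.num ℓ = -1 ∧ Zhang2014.IsKolyvaginPrime N W K 2 ℓ ∧ 1 ≤ Zhang2014.kolyvaginIndex W 2 ℓ ∧
      ∀ v : HeightOneSpectrum (𝓞 ℚ), (ℓ : 𝓞 ℚ) ∈ v.asIdeal →
        s ∉ W.torsionLocalKer (v.adicCompletion ℚ) 2 ∧ y ∉ W.torsionLocalKer (v.adicCompletion ℚ) 2 := by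
  have h2K : Module.finrank ℚ K = 2 := hK.1
  have hL : ∀ P : (W.baseChange K).toAffine.Point, (2 : ℤ) • P = 0 → P = 0 := fun P hP =>
    forall_zsmul_two_pow_baseChange_eq_zero_of_hasSurjectiveModNGaloisRep_two W K h2K hsurj 1 P (by simpa using hP)
  have hresinj : Function.Injective (resTorsion W K 2) := resTorsion_injective_of_noTorsion W K h2K hθ hcθ _ hL
  have hrs0 : resTorsion W K 2 s ≠ 0 := fun h => hs0 (hresinj (by rw [h, map_zero]))
  have hry0 : resTorsion W K 2 y ≠ 0 := fun h => hy0 (hresinj (by rw [h, map_zero]))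
  have hrsy : resTorsion W K 2 s ≠ resTorsion W K 2 y := fun h => hsy (hresinj h)
  have h2s : (2 : ℤ) • resTorsion W K 2 s = 0 := by exact_mod_cast zsmul_galH1Torsion_eq_zero (W.baseChange K) 2 _
  have h2y : (2 : ℤ) • resTorsion W K 2 y = 0 := by exact_mod_cast zsmul_galH1Torsion_eq_zero (W.baseChange K) 2 _
  obtain ⟨ℓ, hbℓ, hjac, hKol, hidx, hloc⟩ := exists_regularKolyvaginPrime_two N W hN hΔ hK hns hsurj hθ hcθ hΔ' ![s, y] ![0, 0]
    (fun a ha => by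
      rw [Fin.sum_univ_two] at ha
      simp only [Matrix.cons_val_zero, Matrix.cons_val_one, map_zero, add_zero] at ha
      obtain ⟨h0, h1⟩ := zsmul_eq_zero_and_of_pair h2s h2y hrs0 hry0 hrsy ha
      intro i
      fin_cases i
      · exact two_dvd_of_zsmul_eq_zero h2s hrs0 h0
      · exact two_dvd_of_zsmul_eq_zero h2y hry0 h1) b
  refine ⟨ℓ, hbℓ, hjac, hKol, hidx, fun v hv => ?_⟩
  have h0mem : (0 : galH1Torsion (W.quadraticTwist d) 2) ∈ (W.quadraticTwist d).torsionLocalKer (v.adicCompletion ℚ) 2 :=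
    AddSubgroup.zero_mem _
  constructor
  · have h := hloc 0
    simp only [Matrix.cons_val_zero] at h
    exact (not_mem_and_of_not_mem_place W hθ hcθ hKol.1 hKol.2.2.2.2.1 s 0 h hv).2 h0mem
  · have h := hloc 1
    simp only [Matrix.cons_val_one] at h
    exact (not_mem_and_of_not_mem_place W hθ hcθ hKol.1 hKol.2.2.2.2.1 y 0 h hv).2 h0mem

/-- **`ceb₁` at `Δ_W > 0` — a regular Kolyvagin prime at which ONE non-zero class `y ∈ H¹(ℚ, W[2])` does not vanish.**
[cite: McCallumLMS1991, §3 Cor. 3.2] [cite: GrossLMS1991, §10] -/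
theorem ceb₁_pos_rat (hN : W.conductorNorm ℤ ∣ N) (hΔ : 0 < W.Δ) (hK : IsImaginaryQuadratic K)
    (hns : ¬ IsSquare ((NumberField.discr K : ℚ) * W.Δ)) (hsurj : W.HasSurjectiveModNGaloisRep 2)
    {θ : K} (hθ : θ ∉ Set.range (algebraMap ℚ K)) {d : ℚ} (hcθ : θ ^ 2 = algebraMap ℚ K d)
    [(W.quadraticTwist d).IsElliptic] (hΔ' : 0 < (W.quadraticTwist d).Δ)
    (y : galH1Torsion W 2) (hy0 : y ≠ 0) (b : ℕ) :
    ∃ ℓ : ℕ, b < ℓ ∧ jacobiSym W.Δ.num ℓ = -1 ∧ Zhang2014.IsKolyvaginPrime N W K 2 ℓ ∧ 1 ≤ Zhang2014.kolyvaginIndex W 2 ℓ ∧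
      ∀ v : HeightOneSpectrum (𝓞 ℚ), (ℓ : 𝓞 ℚ) ∈ v.asIdeal → y ∉ W.torsionLocalKer (v.adicCompletion ℚ) 2 := by
  have h2K : Module.finrank ℚ K = 2 := hK.1
  have hL : ∀ P : (W.baseChange K).toAffine.Point, (2 : ℤ) • P = 0 → P = 0 := fun P hP =>
    forall_zsmul_two_pow_baseChange_eq_zero_of_hasSurjectiveModNGaloisRep_two W K h2K hsurj 1 P (by simpa using hP)
  have hresinj : Function.Injective (resTorsion W K 2) := resTorsion_injective_of_noTorsion W K h2K hθ hcθ _ hL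
  have hry0 : resTorsion W K 2 y ≠ 0 := fun h => hy0 (hresinj (by rw [h, map_zero]))
  have h2y : (2 : ℤ) • resTorsion W K 2 y = 0 := by exact_mod_cast zsmul_galH1Torsion_eq_zero (W.baseChange K) 2 _
  obtain ⟨ℓ, hbℓ, hjac, hKol, hidx, hloc⟩ := exists_regularKolyvaginPrime_two N W hN hΔ hK hns hsurj hθ hcθ hΔ' ![y] ![0]
    (fun a ha => by
      rw [Fin.sum_univ_one] at ha
      simp only [Matrix.cons_val_zero, map_zero, add_zero] at ha
      intro i
      fin_cases i
      exact two_dvd_of_zsmul_eq_zero h2y hry0 ha) b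
  refine ⟨ℓ, hbℓ, hjac, hKol, hidx, fun v hv => ?_⟩
  have h := hloc 0
  simp only [Matrix.cons_val_zero] at h
  exact (not_mem_and_of_not_mem_place W hθ hcθ hKol.1 hKol.2.2.2.2.1 y 0 h hv).2 (AddSubgroup.zero_mem _)

/-- **`ceb₂'` at `Δ_W > 0` — the regular-prime Čebotarev for a CROSS PAIR**: `s' ∈ H¹(ℚ, W^{(d)}[2])` and `y ∈ H¹(ℚ, W[2])` non-zero (NO
distinctness hypothesis: the «twin copy of `y`», `hPsiKT (res s') = res y`, is served by the single-class family — at the place `λ` of a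
prime singular for `res y` the copy is singular too).  Conclusion: a regular Kolyvagin prime `ℓ > b` with `s' ∉ torsionLocalKer_v(W^{(d)})`
and `y ∉ torsionLocalKer_v(W)` at `v ∋ ℓ`. [cite: McCallumLMS1991, §3 Cor. 3.2 and p. 299] [cite: Kolyvagin1989Izv, §3] -/
theorem ceb₂'_pos_rat (hN : W.conductorNorm ℤ ∣ N) (hΔ : 0 < W.Δ) (hK : IsImaginaryQuadratic K)
    (hns : ¬ IsSquare ((NumberField.discr K : ℚ) * W.Δ)) (hsurj : W.HasSurjectiveModNGaloisRep 2)
    {θ : K} (hθ : θ ∉ Set.range (algebraMap ℚ K)) {d : ℚ} (hcθ : θ ^ 2 = algebraMap ℚ K d)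
    [(W.quadraticTwist d).IsElliptic] (hΔ' : 0 < (W.quadraticTwist d).Δ)
    (s' : galH1Torsion (W.quadraticTwist d) 2) (y : galH1Torsion W 2) (hs0 : s' ≠ 0) (hy0 : y ≠ 0) (b : ℕ) :
    ∃ ℓ : ℕ, b < ℓ ∧ jacobiSym W.Δ.num ℓ = -1 ∧ Zhang2014.IsKolyvaginPrime N W K 2 ℓ ∧ 1 ≤ Zhang2014.kolyvaginIndex W 2 ℓ ∧
      ∀ v : HeightOneSpectrum (𝓞 ℚ), (ℓ : 𝓞 ℚ) ∈ v.asIdeal →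
        s' ∉ (W.quadraticTwist d).torsionLocalKer (v.adicCompletion ℚ) 2 ∧ y ∉ W.torsionLocalKer (v.adicCompletion ℚ) 2 := by
  have h2K : Module.finrank ℚ K = 2 := hK.1
  have hL : ∀ P : (W.baseChange K).toAffine.Point, (2 : ℤ) • P = 0 → P = 0 := fun P hP =>
    forall_zsmul_two_pow_baseChange_eq_zero_of_hasSurjectiveModNGaloisRep_two W K h2K hsurj 1 P (by simpa using hP)
  have hresinj : Function.Injective (resTorsion W K 2) := resTorsion_injective_of_noTorsion W K h2K hθ hcθ _ hL
  have hresinj' : Function.Injective (resTorsion (W.quadraticTwist d) K 2) := resTorsion_twist_injective_of_noTorsion W K h2K hθ hcθ _ hL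
  have hry0 : resTorsion W K 2 y ≠ 0 := fun h => hy0 (hresinj (by rw [h, map_zero]))
  have hu0 : hPsiKT W K hθ hcθ 2 (resTorsion (W.quadraticTwist d) K 2 s') ≠ 0 := fun h => hs0 (hresinj' (by
    rw [map_zero]; exact (hPsiKT W K hθ hcθ 2).injective (by rw [h, map_zero])))
  have h2y : (2 : ℤ) • resTorsion W K 2 y = 0 := by exact_mod_cast zsmul_galH1Torsion_eq_zero (W.baseChange K) 2 _
  have h2u : (2 : ℤ) • hPsiKT W K hθ hcθ 2 (resTorsion (W.quadraticTwist d) K 2 s') = 0 := by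
    exact_mod_cast zsmul_galH1Torsion_eq_zero (W.baseChange K) 2 _
  by_cases hcopy : hPsiKT W K hθ hcθ 2 (resTorsion (W.quadraticTwist d) K 2 s') = resTorsion W K 2 y
  · -- the twin copy of `y`: the single-class family `((y, 0))`
    obtain ⟨ℓ, hbℓ, hjac, hKol, hidx, hloc⟩ := exists_regularKolyvaginPrime_two N W hN hΔ hK hns hsurj hθ hcθ hΔ' ![y] ![0]
      (fun a ha => by
        rw [Fin.sum_univ_one] at ha
        simp only [Matrix.cons_val_zero, map_zero, add_zero] at ha
        intro i
        fin_cases i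
        exact two_dvd_of_zsmul_eq_zero h2y hry0 ha) b
    refine ⟨ℓ, hbℓ, hjac, hKol, hidx, fun v hv => ?_⟩
    have h := hloc 0
    simp only [Matrix.cons_val_zero, map_zero, add_zero] at h
    -- `res 0 + hPsiKT (res s') = u = res y`
    have h' : ∀ w : HeightOneSpectrum (𝓞 K), (ℓ : 𝓞 K) ∈ w.asIdeal →
        resTorsion W K 2 0 + hPsiKT W K hθ hcθ 2 (resTorsion (W.quadraticTwist d) K 2 s') ∉
          (W.baseChange K).torsionLocalKer (w.adicCompletion K) 2 := fun w hw => by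
      rw [map_zero, zero_add, hcopy]; exact h w hw
    have h'' : ∀ w : HeightOneSpectrum (𝓞 K), (ℓ : 𝓞 K) ∈ w.asIdeal →
        resTorsion W K 2 y + hPsiKT W K hθ hcθ 2 (resTorsion (W.quadraticTwist d) K 2 0) ∉
          (W.baseChange K).torsionLocalKer (w.adicCompletion K) 2 := fun w hw => by
      rw [map_zero, map_zero, add_zero]; exact h w hw
    exact ⟨(not_mem_and_of_not_mem_place W hθ hcθ hKol.1 hKol.2.2.2.2.1 0 s' h' hv).1 (AddSubgroup.zero_mem _),
      (not_mem_and_of_not_mem_place W hθ hcθ hKol.1 hKol.2.2.2.2.1 y 0 h'' hv).2 (AddSubgroup.zero_mem _)⟩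
  · -- the generic case: the family `((0, s'), (y, 0))`
    obtain ⟨ℓ, hbℓ, hjac, hKol, hidx, hloc⟩ := exists_regularKolyvaginPrime_two N W hN hΔ hK hns hsurj hθ hcθ hΔ' ![0, y] ![s', 0]
      (fun a ha => by
        rw [Fin.sum_univ_two] at ha
        simp only [Matrix.cons_val_zero, Matrix.cons_val_one, map_zero, add_zero, zero_add] at ha
        obtain ⟨h0, h1⟩ := zsmul_eq_zero_and_of_pair h2u h2y hu0 hry0 hcopy ha
        intro i
        fin_cases i
        · exact two_dvd_of_zsmul_eq_zero h2u hu0 h0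
        · exact two_dvd_of_zsmul_eq_zero h2y hry0 h1) b
    refine ⟨ℓ, hbℓ, hjac, hKol, hidx, fun v hv => ?_⟩
    have h0 := hloc 0
    have h1 := hloc 1
    simp only [Matrix.cons_val_zero] at h0
    simp only [Matrix.cons_val_one] at h1
    exact ⟨(not_mem_and_of_not_mem_place W hθ hcθ hKol.1 hKol.2.2.2.2.1 0 s' h0 hv).1 (AddSubgroup.zero_mem _),
      (not_mem_and_of_not_mem_place W hθ hcθ hKol.1 hKol.2.2.2.2.1 y 0 h1 hv).2 (AddSubgroup.zero_mem _)⟩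

end Shapes

end Summit.BirchSwinnertonDyer.BirchSwinnertonDyer.Theorems.RankOneAtTwoOneDoor

end
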